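import Summits.QuantumFields.YangMills.Theorems.BalabanUVNodesN08HaarCompatibilityGuardChartTransfer
import Literature.MathematicalPhysics.QuantumFieldTheory.Balaban1983to89.B15Prop1ChartSU2
import Literature.MathematicalPhysics.QuantumFieldTheory.Balaban1983to89.BlockAveragingHaarAC

/-!
# BalabanUVNodes ∕ N08 — ONE WINDOW SUFFICES: the guard-admitting set of the lattice-free core map lies in a single `dist1`-ball of radius `2δ`, which at
# `N = 2` is one chart window `w₀·exp(i·ball(0, πδ))`; hence (H_K-core) at `N = 2` follows from ONE injective differentiable chart conjugate with
# Haar-Jacobian floor `m` on that window, with `K = m⁻¹ + 1`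

WIDTH SEAT `pub-ymgap-dag-n08-w3` g4, `W-SEAT-START-LIST.md` v10 §0 (iii); item-3 lineage part 25 = the junction of part 21 (the frame, p616325) with the guard
geometry, 2026-08-28.  DAG node N08 = [Balaban1985UV3] Thm 1 p. 257 + Thm 2 p. 272; [Balaban1987RG1] (0.4) p. 253 (the typed averaging and its guard); key item K1⁷
`StabilityBAtRecordR13SepCoPH` (stmt-QuantumFields-20542), `--supports … --as helper`.  COUNT-NEUTRAL.

WHAT THIS FILE PROVES (theorems only, 0 def; [folklore] group ∕ chart bookkeeping; nothing of Bałaban's asserted).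
 §1 (any gauge group) `dist1_inv_mul_lt_of_near` ∕ ★ `coreGuard_subset_ball`: if `V_{i₀}·w₀⁻¹` and `V_{i₀}·w⁻¹` are both `δ`-close to `1` then `dist1(w₀⁻¹w) < 2δ`;
    so the guard-admitting set `{w | ∀ i, dist1((1 | Vᵢw⁻¹)) < δ}` of part 24's core map lies in the ball `{w | dist1(w₀⁻¹w) < 2δ}` around ANY of its points
    (one non-central index suffices).
 §2 (`SU(2)`) `ball_dist1_subset_window`: `{w | dist1(w₀⁻¹w) < ρ} ⊆ w₀·exp(i·ball(0, r))` for `(π∕2)ρ ≤ r` — print's chart is onto with `‖(1∕i) log U‖ ≤ (π∕2)|U − 1|`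
    (`B15Prop1ChartSU2.iexp_ilog`, `norm_ilog_le`; `expPauli = expPoint ∘ rev`).
 §3 ★★ `haar_map_le_of_one_window`: part 21's frame with ONE window and `τ = id`: a Borel `ψ : SU(2) → SU(2)` with `ψ = id` off a measurable `S ⊆ {dist1(w₀⁻¹·) < ρ}`,
    `(π∕2)ρ ≤ r ≤ π`, chart-conjugate on `W = ball(0,r) ∩ {A | w₀·exp iA ∈ S}` to an injective differentiable `ψc` (`ψ(w₀ exp iA) = w₁ exp(iψc A)`, `ψc(W) ⊆ {|A|<π}`)
    with Haar-Jacobian floor `m ∈ (0, ∞)` ⟹ `Haar∘ψ⁻¹ ≤ (m⁻¹ + 1)•Haar`;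
 §4 ★★ `core_law_le_of_one_window`: the same for part 24's CORE MAP `Φ_V(w) = (if guard then ℰ.avg F_V(w) else 1)·w` of any small-loop average `ℰ` on `SU(2)`:
    ONE injective differentiable chart conjugate with floor `m` on the window of radius `r ≥ πδ` around a guard-admitting point gives (H_K-core) with `K = m⁻¹ + 1`.

WHAT IS LEFT (located): the chart conjugate `ψc` of the printed core map `w ↦ exp(Σᵢcᵢ log(Vᵢw*))·w` (pub-balaban's `Kmat`) on that window — its differentiability
through the chart and the floor `m` from n08-w6's determinant form (p612264 `emlD_tangent_lower_bound_sharp`: `(1−Σcᵢ)²·hs X X ≤ hs (emlD …)(…)`), and its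
injectivity on the window (part 22's coercivity tools).  HONEST FRAMING: (H_K) ∕ (H_K-core) NOT discharged; E6′ NOT decided; `hmass` NOT supplied; count-neutral;
N08 NOT discharged; counts unmoved (typed 28∕28 · discharged 5∕27); one finite 𝕋⁴ programme at fixed ε — R4 closes the CONDITIONAL rung `BalabanLadder.UV` only;
the Yang–Mills mass gap (Clay) is NOT proved; nothing continuum ∕ OS.  0 `sorry`, standard axioms.
-/

noncomputable section

open MeasureTheory Set Metric Function
open scoped ENNReal

namespace Summit.QuantumFields.YangMills.BalabanUVNodes.N08HaarCompatibilityGuardOneWindow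

open Literature.MathematicalPhysics.QuantumFieldTheory (haarProbability)
open Literature.MathematicalPhysics.QuantumFieldTheory.Balaban1983to89
open Literature.MathematicalPhysics.QuantumFieldTheory.Balaban1983to89.BlockAveraging (Idx)
open Literature.MathematicalPhysics.QuantumFieldTheory.Balaban1983to89.BlockAveragingHaarAC (IsCentral)
open Literature.MathematicalPhysics.QuantumFieldTheory.Balaban1983to89.B10Eq22Rescaling (sigmaSU2)
open Literature.MathematicalPhysics.QuantumFieldTheory.Balaban1983to89.B10Eq18SigmaSU2Haar (rev rev_rev norm_rev expPauli expPauli_eq_expPoint)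
open Literature.MathematicalPhysics.QuantumFieldTheory.Balaban1983to89.B15Prop1ChartSU2 (su2Chart su2Chart_iexp iexp_ilog norm_ilog_le)
open Summit.QuantumFields.YangMills.BalabanUVNodes.N08HaarCompatibilityGuardChartTransfer (haar_map_le_of_windows)

/-! ## §1 The guard-admitting set of the core map lies in one `dist1`-ball -/

section Ball

variable {G : Type*} [GaugeGroup G]

/-- Two elements whose `V`-translates are `δ`-close to `1` are `2δ`-close: `dist1(V w₀⁻¹) < δ`, `dist1(V w⁻¹) < δ` ⟹ `dist1(w₀⁻¹ w) < δ + δ`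
(`w₀⁻¹w` is conjugate to `(V w₀⁻¹)⁻¹(V w⁻¹)… ` — triangle inequality, inversion and conjugation invariance of `|· − 1|`). [folklore] -/
theorem dist1_inv_mul_lt_of_near {V w₀ w : G} {δ : ℝ} (h₀ : dist1 (V * w₀⁻¹) < δ) (h : dist1 (V * w⁻¹) < δ) : dist1 (w₀⁻¹ * w) < δ + δ := by
  have h1 : w₀⁻¹ * w = w⁻¹ * ((V * w⁻¹)⁻¹ * (V * w₀⁻¹)) * w⁻¹⁻¹ := by group
  rw [h1, GaugeGroup.dist1_conj]
  calc dist1 ((V * w⁻¹)⁻¹ * (V * w₀⁻¹)) ≤ dist1 (V * w⁻¹)⁻¹ + dist1 (V * w₀⁻¹) := GaugeGroup.dist1_mul_le _ _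
    _ = dist1 (V * w⁻¹) + dist1 (V * w₀⁻¹) := by rw [GaugeGroup.dist1_inv]
    _ < δ + δ := add_lt_add h h₀

/-- ★ **THE GUARD-ADMITTING SET OF THE CORE MAP LIES IN ONE BALL**: for the core family `F_V(w)ᵢ = (1 if i central | Vᵢ·w⁻¹)` of part 24 and any point `w₀` of its
guard set, `{w | ∀ i, dist1(F_V(w)ᵢ) < δ} ⊆ {w | dist1(w₀⁻¹w) < 2δ}` — provided some index is NOT central. [cite: Balaban1987RG1, (0.4) p.253 (bookkeeping)] -/
theorem coreGuard_subset_ball {P : Params} {j : ℕ} (c : PBond P (j + 1)) (V : Idx P → G) (δ : ℝ) {i₀ : Idx P} (hi₀ : ¬ IsCentral c i₀) {w₀ : G}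
    (hw₀ : ∀ i : Idx P, dist1 (if IsCentral c i then (1 : G) else V i * w₀⁻¹) < δ) :
    {w : G | ∀ i : Idx P, dist1 (if IsCentral c i then (1 : G) else V i * w⁻¹) < δ} ⊆ {w : G | dist1 (w₀⁻¹ * w) < 2 * δ} := by
  intro w hw
  have h₀ := hw₀ i₀
  have h := hw i₀
  rw [if_neg hi₀] at h₀
  simp only [if_neg hi₀] at h
  rw [mem_setOf_eq, two_mul]
  exact dist1_inv_mul_lt_of_near h₀ h

end Ball

/-! ## §2 At `SU(2)`: a `dist1`-ball is inside one chart window -/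

section SU2

/-- **A `dist1`-BALL IS A CHART WINDOW**: `{w | dist1(w₀⁻¹w) < ρ} ⊆ w₀·exp(i·ball(0, r))` whenever `(π∕2)ρ ≤ r` — print's chart is onto `SU(2)` with
`‖(1∕i) log U‖ ≤ (π∕2)·|U − 1|`. [cite: Balaban1989LargeFieldII, p.360 (the chart letters; bookkeeping)] -/
theorem ball_dist1_subset_window (w₀ : Matrix.specialUnitaryGroup (Fin 2) ℂ) {ρ r : ℝ} (hr : Real.pi / 2 * ρ ≤ r) :
    {w : Matrix.specialUnitaryGroup (Fin 2) ℂ | dist1 (w₀⁻¹ * w) < ρ} ⊆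
      (fun A : EuclideanSpace ℝ (Fin 3) => w₀ * expPauli A) '' ball (0 : EuclideanSpace ℝ (Fin 3)) r := by
  intro w hw
  refine ⟨rev (su2Chart.ilog (w₀⁻¹ * w)), ?_, ?_⟩
  · rw [mem_ball_zero_iff, norm_rev]
    calc ‖su2Chart.ilog (w₀⁻¹ * w)‖ ≤ Real.pi / 2 * dist1 (w₀⁻¹ * w) := norm_ilog_le _
      _ < Real.pi / 2 * ρ := mul_lt_mul_of_pos_left hw (by positivity)
      _ ≤ r := hr
  · show w₀ * expPauli (rev (su2Chart.ilog (w₀⁻¹ * w))) = w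
    rw [expPauli_eq_expPoint, rev_rev, ← su2Chart_iexp, iexp_ilog, mul_inv_cancel_left]

/-- ★★ **ONE WINDOW, `τ = id`** (part 21's frame specialised): `ψ : SU(2) → SU(2)` Borel, `ψ w = w` off a measurable `S ⊆ {w | dist1(w₀⁻¹w) < ρ}`,
`(π∕2)ρ ≤ r ≤ π`; on `W = ball(0, r) ∩ {A | w₀·exp iA ∈ S}` let `ψ(w₀·exp iA) = w₁·exp(iψc(A))` with `ψc` injective and differentiable on `W`, `ψc(W) ⊆ {|A| < π}`,
and the Haar-Jacobian floor `m·σ(|A|) ≤ |det ψc′(A)|·σ(|ψc A|)`, `0 < m < ∞`.  Then `Haar ∘ ψ⁻¹ ≤ (m⁻¹ + 1) • Haar`.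
[cite: Balaban1985UV3, p. 260 (the chart `dU′ = σ(A′)dA′`; bookkeeping)] -/
theorem haar_map_le_of_one_window {ψ : Matrix.specialUnitaryGroup (Fin 2) ℂ → Matrix.specialUnitaryGroup (Fin 2) ℂ} (hψ : Measurable ψ)
    {S : Set (Matrix.specialUnitaryGroup (Fin 2) ℂ)} (hSm : MeasurableSet S) (heq : ∀ w, w ∉ S → ψ w = w)
    (w₀ w₁ : Matrix.specialUnitaryGroup (Fin 2) ℂ) {ρ r : ℝ} (hSρ : S ⊆ {w | dist1 (w₀⁻¹ * w) < ρ}) (hr : Real.pi / 2 * ρ ≤ r) (hrπ : r ≤ Real.pi)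
    {ψc : EuclideanSpace ℝ (Fin 3) → EuclideanSpace ℝ (Fin 3)}
    {ψc' : EuclideanSpace ℝ (Fin 3) → EuclideanSpace ℝ (Fin 3) →L[ℝ] EuclideanSpace ℝ (Fin 3)}
    (hconj : ∀ A ∈ ball (0 : EuclideanSpace ℝ (Fin 3)) r ∩ {A | w₀ * expPauli A ∈ S}, ψ (w₀ * expPauli A) = w₁ * expPauli (ψc A))
    (hmaps : MapsTo ψc (ball (0 : EuclideanSpace ℝ (Fin 3)) r ∩ {A | w₀ * expPauli A ∈ S}) (ball (0 : EuclideanSpace ℝ (Fin 3)) Real.pi))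
    (hder : ∀ A ∈ ball (0 : EuclideanSpace ℝ (Fin 3)) r ∩ {A | w₀ * expPauli A ∈ S},
      HasFDerivWithinAt ψc (ψc' A) (ball (0 : EuclideanSpace ℝ (Fin 3)) r ∩ {A | w₀ * expPauli A ∈ S}) A)
    (hinj : InjOn ψc (ball (0 : EuclideanSpace ℝ (Fin 3)) r ∩ {A | w₀ * expPauli A ∈ S})) {m : ℝ≥0∞} (hm0 : m ≠ 0) (hmt : m ≠ ∞)
    (hm : ∀ A ∈ ball (0 : EuclideanSpace ℝ (Fin 3)) r ∩ {A | w₀ * expPauli A ∈ S},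
      m * ENNReal.ofReal (sigmaSU2 ‖A‖) ≤ ENNReal.ofReal |(ψc' A).det| * ENNReal.ofReal (sigmaSU2 ‖ψc A‖)) :
    (haarProbability (Matrix.specialUnitaryGroup (Fin 2) ℂ)).map ψ ≤ (m⁻¹ + 1) • haarProbability (Matrix.specialUnitaryGroup (Fin 2) ℂ) := by
  have hWm : MeasurableSet (ball (0 : EuclideanSpace ℝ (Fin 3)) r ∩ {A | w₀ * expPauli A ∈ S}) :=
    measurableSet_ball.inter ((measurable_const_mul w₀).comp
      Literature.MathematicalPhysics.QuantumFieldTheory.Balaban1983to89.B10Eq18SigmaSU2Haar.measurable_expPauli hSm)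
  have hcover : S ⊆ ⋃ k ∈ ({()} : Finset Unit), (fun A : EuclideanSpace ℝ (Fin 3) => w₀ * expPauli A) '' (ball (0 : EuclideanSpace ℝ (Fin 3)) r ∩ {A | w₀ * expPauli A ∈ S}) := by
    intro w hw
    obtain ⟨A, hA, hAw⟩ := ball_dist1_subset_window w₀ hr (hSρ hw)
    have hAw' : w₀ * expPauli A = w := hAw
    refine mem_iUnion₂.2 ⟨(), Finset.mem_singleton_self _, A, ⟨hA, ?_⟩, hAw⟩
    show w₀ * expPauli A ∈ S
    rw [hAw']
    exact hw
  have h := haar_map_le_of_windows hψ measurable_id (by rw [Measure.map_id]) hSm (fun w hw => heq w hw) ({()} : Finset Unit)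
    (fun _ => w₀) (fun _ => w₁) (fun _ => ball (0 : EuclideanSpace ℝ (Fin 3)) r ∩ {A | w₀ * expPauli A ∈ S}) (fun _ _ => hWm)
    (fun _ _ => inter_subset_left.trans (ball_subset_ball hrπ)) (fun _ => ψc) (fun _ => ψc') (fun _ _ => hconj) (fun _ _ => hmaps)
    (fun _ _ => hder) (fun _ _ => hinj) hm0 hmt (fun _ _ => hm) hcover
  simpa using h

/-- ★★ **(H_K-core) AT `N = 2` FROM ONE WINDOW**: for any small-loop average `ℰ` on `SU(2)` (radius `δ`), any central set with a non-central index, any family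
`V`, and a guard-admitting point `w₀`: if the core map `Φ_V(w) = (if ∀ i, dist1(F_V(w)ᵢ) < δ then ℰ.avg F_V(w) else 1)·w` (Borel) is, on the window
`W = ball(0, r) ∩ {A | w₀·exp iA guard-admitting}` with `πδ ≤ r ≤ π`, chart-conjugate to an injective differentiable `ψc` with Haar-Jacobian floor `m ∈ (0,∞)`,
then **`Haar ∘ Φ_V⁻¹ ≤ (m⁻¹ + 1) • Haar`**. [cite: Balaban1987RG1, (0.4) p.253; Balaban1985UV3, p.260 (bookkeeping — nothing of print asserted)] -/
theorem core_law_le_of_one_window {P : Params} {j : ℕ} (ℰ : LoopAverage (Matrix.specialUnitaryGroup (Fin 2) ℂ)) (c : PBond P (j + 1))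
    (V : Idx P → Matrix.specialUnitaryGroup (Fin 2) ℂ) {i₀ : Idx P} (hi₀ : ¬ IsCentral c i₀) {w₀ : Matrix.specialUnitaryGroup (Fin 2) ℂ}
    (hw₀ : ∀ i : Idx P, dist1 (if IsCentral c i then (1 : Matrix.specialUnitaryGroup (Fin 2) ℂ) else V i * w₀⁻¹) < ℰ.δ)
    (hΦ : Measurable fun w : Matrix.specialUnitaryGroup (Fin 2) ℂ =>
      (if ∀ i : Idx P, dist1 (if IsCentral c i then (1 : Matrix.specialUnitaryGroup (Fin 2) ℂ) else V i * w⁻¹) < ℰ.δ then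
          ℰ.avg (fun i : Idx P => if IsCentral c i then (1 : Matrix.specialUnitaryGroup (Fin 2) ℂ) else V i * w⁻¹) else 1) * w)
    (hSm : MeasurableSet {w : Matrix.specialUnitaryGroup (Fin 2) ℂ |
      ∀ i : Idx P, dist1 (if IsCentral c i then (1 : Matrix.specialUnitaryGroup (Fin 2) ℂ) else V i * w⁻¹) < ℰ.δ})
    {r : ℝ} (hr : Real.pi * ℰ.δ ≤ r) (hrπ : r ≤ Real.pi) (w₁ : Matrix.specialUnitaryGroup (Fin 2) ℂ)
    {ψc : EuclideanSpace ℝ (Fin 3) → EuclideanSpace ℝ (Fin 3)}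
    {ψc' : EuclideanSpace ℝ (Fin 3) → EuclideanSpace ℝ (Fin 3) →L[ℝ] EuclideanSpace ℝ (Fin 3)}
    (hconj : ∀ A ∈ ball (0 : EuclideanSpace ℝ (Fin 3)) r ∩ {A | w₀ * expPauli A ∈ {w : Matrix.specialUnitaryGroup (Fin 2) ℂ |
        ∀ i : Idx P, dist1 (if IsCentral c i then (1 : Matrix.specialUnitaryGroup (Fin 2) ℂ) else V i * w⁻¹) < ℰ.δ}},
      (if ∀ i : Idx P, dist1 (if IsCentral c i then (1 : Matrix.specialUnitaryGroup (Fin 2) ℂ) else V i * (w₀ * expPauli A)⁻¹) < ℰ.δ then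
          ℰ.avg (fun i : Idx P => if IsCentral c i then (1 : Matrix.specialUnitaryGroup (Fin 2) ℂ) else V i * (w₀ * expPauli A)⁻¹) else 1) *
        (w₀ * expPauli A) = w₁ * expPauli (ψc A))
    (hmaps : MapsTo ψc (ball (0 : EuclideanSpace ℝ (Fin 3)) r ∩ {A | w₀ * expPauli A ∈ {w : Matrix.specialUnitaryGroup (Fin 2) ℂ |
        ∀ i : Idx P, dist1 (if IsCentral c i then (1 : Matrix.specialUnitaryGroup (Fin 2) ℂ) else V i * w⁻¹) < ℰ.δ}})
      (ball (0 : EuclideanSpace ℝ (Fin 3)) Real.pi))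
    (hder : ∀ A ∈ ball (0 : EuclideanSpace ℝ (Fin 3)) r ∩ {A | w₀ * expPauli A ∈ {w : Matrix.specialUnitaryGroup (Fin 2) ℂ |
        ∀ i : Idx P, dist1 (if IsCentral c i then (1 : Matrix.specialUnitaryGroup (Fin 2) ℂ) else V i * w⁻¹) < ℰ.δ}},
      HasFDerivWithinAt ψc (ψc' A) (ball (0 : EuclideanSpace ℝ (Fin 3)) r ∩ {A | w₀ * expPauli A ∈ {w : Matrix.specialUnitaryGroup (Fin 2) ℂ |
        ∀ i : Idx P, dist1 (if IsCentral c i then (1 : Matrix.specialUnitaryGroup (Fin 2) ℂ) else V i * w⁻¹) < ℰ.δ}}) A)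
    (hinj : InjOn ψc (ball (0 : EuclideanSpace ℝ (Fin 3)) r ∩ {A | w₀ * expPauli A ∈ {w : Matrix.specialUnitaryGroup (Fin 2) ℂ |
        ∀ i : Idx P, dist1 (if IsCentral c i then (1 : Matrix.specialUnitaryGroup (Fin 2) ℂ) else V i * w⁻¹) < ℰ.δ}}))
    {m : ℝ≥0∞} (hm0 : m ≠ 0) (hmt : m ≠ ∞)
    (hm : ∀ A ∈ ball (0 : EuclideanSpace ℝ (Fin 3)) r ∩ {A | w₀ * expPauli A ∈ {w : Matrix.specialUnitaryGroup (Fin 2) ℂ |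
        ∀ i : Idx P, dist1 (if IsCentral c i then (1 : Matrix.specialUnitaryGroup (Fin 2) ℂ) else V i * w⁻¹) < ℰ.δ}},
      m * ENNReal.ofReal (sigmaSU2 ‖A‖) ≤ ENNReal.ofReal |(ψc' A).det| * ENNReal.ofReal (sigmaSU2 ‖ψc A‖)) :
    (haarProbability (Matrix.specialUnitaryGroup (Fin 2) ℂ)).map (fun w : Matrix.specialUnitaryGroup (Fin 2) ℂ =>
      (if ∀ i : Idx P, dist1 (if IsCentral c i then (1 : Matrix.specialUnitaryGroup (Fin 2) ℂ) else V i * w⁻¹) < ℰ.δ then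
          ℰ.avg (fun i : Idx P => if IsCentral c i then (1 : Matrix.specialUnitaryGroup (Fin 2) ℂ) else V i * w⁻¹) else 1) * w) ≤
      (m⁻¹ + 1) • haarProbability (Matrix.specialUnitaryGroup (Fin 2) ℂ) := by
  refine haar_map_le_of_one_window hΦ hSm (fun w hw => ?_) w₀ w₁ (coreGuard_subset_ball c V ℰ.δ hi₀ hw₀) (by linarith) hrπ hconj hmaps hder hinj
    hm0 hmt hm
  have hw' : ¬ ∀ i : Idx P, dist1 (if IsCentral c i then (1 : Matrix.specialUnitaryGroup (Fin 2) ℂ) else V i * w⁻¹) < ℰ.δ := hw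
  simp only [if_neg hw', one_mul]

end SU2

end Summit.QuantumFields.YangMills.BalabanUVNodes.N08HaarCompatibilityGuardOneWindow

end
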